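import Literature.MathematicalPhysics.QuantumFieldTheory.Balaban1983to89.T4CondMeanChannelInsert
import Literature.MathematicalPhysics.QuantumFieldTheory.Balaban1983to89.T4CubeChartTransport

/-!
# `Balaban1983to89.T4PairResponseChart` — the cube Brascamp–Lieb engine feeds the (PVAR) slots of the PAIR RESPONSE:
# chart transport of the law path `old ↔ ins` at a fixed exterior (audit cell `pub-balaban`, T⁴ lane, node O3.E)

HONEST FRAMING.  Audit cell `pub-balaban`, unit `b2b-balaban-pv16` (SURGE NODE PROVER #16, gen 12), self-proposed
continuation row **T4-O3.E-NE1′-TEL-INS-PCHART\*** of the carved row T4-O3.E-NE1′-TEL-INS° (`HOME/t4/T4-DAG.md` v17,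
delivered by `T4CondMeanChannelInsert`).  This module is BOOKKEEPING on the cell's OWN typed objects: it types NO sentence
of CMP 109/116/122, proves NO estimate of Bałaban's, and is NOT progress on any Clay-level statement.  Every declaration is
[folklore] (elementary measure theory / calculus on the cell's model objects); no sentence of the audited papers is used as
a hypothesis; all sizes are binders.

CITATION HEADER (LOCATIONS only, repeated from the imported modules; nothing newly quoted, nothing read this session):
[Balaban1989LargeFieldI] = CMP 122:175–202, (0.3)–(0.4) p. 176 and (1.100)–(1.102) p. 201 (the term structure of the
operation ℝ: «integrated large-field factor ρ(Z,·)», «inserted small-field expression ρ(Z″,·)», proviso «the denominators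
are positive» — the `T4DressedR` / `T4ObservableTelescope` census); [Balaban1988RG2Cluster] (2.20) p. 16 (linear part,
`T4FirstOrderSize`).

THE QUESTION (GAPS G-pv16g12-2, residual input (P-b); record `t4/T4-EST-O3Ei1.md` §4i).  ROUTE (P) of
`T4CondMeanChannelInsert` bounds the two-law conditional-mean gap of one term DIRECTLY: where the two windows agree on the
fibre through the exterior `V`, `condLaw s old V` and `condLaw s ins V` are the endpoints `θ = 0, 1` of the LAW PATH
`lawPath s χ₁ h₁ h₂ V θ` (the normalised laws of `χ₁(V←·)·e^{(1−θ)h₁(V←·)+θh₂(V←·)}`), and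
`condMeanGap_linDensity_of_pairVariance` asks, along the old term's live set, for `V ∈ pairDom s χ₁ χ₂ h₁ h₂ B S σ τ`:
the LAW-PATH VARIANCES of the law gap `h₁(V←·) − h₂(V←·)` (`≤ σ²`) and of the bond inserts (`≤ τ²`), uniformly in
`θ ∈ [0,1]` — the (PVAR) inputs, binders there.  ROUTE (R) has the analogous (VAR) inputs (`T4CovarianceResponse.respDom`),
and for those the cell HAS a typed supplier: the cube Brascamp–Lieb–Poincaré inequality (`T4CubePoincare`, pv16-g11)
transported to the group fibre through a chart (`T4CubeChartTransport.mem_respDom_of_cubeChart`, pv28-g9).  Open before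
this module: the same supplier for route (P).

WHAT IS PROVED (all [folklore]; `T4CondMeanChannelInsert` + `T4CubeChartTransport` BY NAME, nothing re-proved or modified).
§1 THE LAW PATH WRITTEN OUT: `expTilt_fibreDensity_lawGap_apply`, `lawPath_eq_normLaw_interp` (the interpolated Gibbs
   density `χ₁(V←y)·e^{(1−θ)h₁(V←y)+θh₂(V←y)}` against the base law of the fibre), `lawPathVar_eq_integral`,
   `integrable_lawInterpDensity` (bounded law gap ⇒ the interpolant is integrable, every real `θ`).
§2 TRANSPORT `lawPathVar_eq_cubeVar`: under pv28's chart hypothesis `CubeChart s χ₁ V n S φ jac` AT THE EXTERIOR `V`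
   ITSELF (the windowed fibre law `χ₁(V←y) Haar^s(dy)` is the `φ`-image of `e^{−jac} 1_{[−S,S]ⁿ} dx`), for ANY `f₁, f₂`
   agreeing on the cube `K` with the transported endpoint exponents `jac − h₁(V←φ·)`, `jac − h₂(V←φ·)`, the law-path
   variance at `θ` of a measurable real insert `F` IS `T4CubePoincare.cubeVar ((1−θ)f₁ + θf₂) S (F∘φ)`; and the law
   gap's chart representative is `f₂ − f₁` EXACTLY (the Jacobian cancels: `lawGap_chart`).
§3 THE PLUG `mem_pairDom_of_cubeChart`: fibre-agreeing windows at `V`, a `K`-bounded law gap, `λ > 0`, `C²`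
   representatives `f₁, f₂` with `HessianBound fᵢ λ` (λ-convexity of BOTH actions in the chart), the gap-gradient bound
   `|∇(f₂ − f₁)|² ≤ b²` on `K` and `C¹` representatives of the real inserts with `|∇|² ≤ L²` on `K`
   ⟹ `V ∈ pairDom s χ₁ χ₂ h₁ h₂ B T (b/√λ) (L/√λ)` — `T4CubePoincare.cubeVar_le_of_grad_le` along the law path, whose
   exponent stays λ-convex (`hessianBound_interp_Icc`).  The packaged datum `PairChartAt s χ₁ χ₂ h₁ h₂ B T λ b L V`
   (`mem_pairDom_of_pairChartAt`).  Compared with pv28's `mem_respDom_of_cubeChart` (route (R)): NO deviation functional,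
   NO reference exterior, NO window blindness between two exteriors — the chart sits at the exterior where the gap is
   wanted, and the convexity input is asked of the two ACTIONS rather than of one action at two exteriors.
§4 BY NAME TO THE LANE: `condMeanGap_linDensity_of_pairCharts` — pair-chart data of common moduli `(λ, b, L)` at every
   old-live exterior ⇒ `CondMeanGap s ins old (linDensity t T a (fibreReading s B)) (|t|·(|T|·A·(b·L/λ)))`
   (`T4CondMeanChannelInsert.condMeanGap_linDensity_of_pairVariance`); `abs_termDefect_le_of_pairCharts` — the increment
   bound `|termDefect s ins old g| ≤ (|t|·(|T|·A·(b·L/λ)) + (q₁ + q₂))·∫dV old` (`abs_termDefect_le_of_pairVariance`).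

§5 (v1.1, APPEND-ONLY over v1 p185528: the declarations of §1–§4 are unchanged) MONOTONICITY AND CLOSURE OF `pairDom`
   IN `(σ, τ)` — the `ε ↓ 0` step of caveat (EXT): `pairDom_mono`, `mem_pairDom_of_forall_gt` (the two variance slots
   are CLOSED conditions), `mem_pairDom_of_forall_lt_modulus` (membership with moduli `(b/√λ', L/√λ')` for every
   `λ' ∈ (0, λ)` gives membership at `λ`) — the `pairDom` copy of pv28's `T4CubeChartTransport` §3 for `respDom`.

HONEST SCOPE / CAVEATS.  (i) NOTHING here is an estimate of Bałaban's: (CHART) — that a windowed one-step fibre law IS a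
cube image (pv28's caveat; U(1): exact with constant Jacobian, row T4-O3.E-iii-b-G7-BLWINDOW-CHART-U1*; SU(N): exponential
chart, windows are not exact cubes), (EXT) — GLOBAL `C²` λ-convex representatives (pv28's `mem_respDom_of_forall_lt_modulus`
is the `ε ↓ 0` step; the extension lemma is not typed), (HESS) — λ-convexity in the chart of BOTH exponents `jac − h₁∘φ`,
`jac − h₂∘φ` (the integrated factor's AND the insert's actions restricted to the fibre; B11 (141)/(142)-type positivity is
the cell's pointer, XREAD-level), the gradient bounds `b` (of the LAW GAP's representative — only its fibre-dependent part
matters) and `L`, and (WIN) (window agreement on the fibre — route (P)'s regime caveat: generic large-field / small-field terms of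
(0.3) do NOT satisfy it, GAPS G-pv16g12-2 (P-a) / Q-ins-WIN) are BINDERS.  (ii) Real inserts only (`E = ℝ`), as in pv28's
plug; vector inserts go componentwise; and NO inhabitant of `PairChartAt` is exhibited (no `CubeChart` instance on a
group fibre exists in the tree yet — vacuity is OPEN, exactly as for pv28's `mem_respDom_of_cubeChart`).  (iii) The moduli `(λ, b, L)` are asked UNIFORMLY along the old term's live set in §4;
nothing says they are K-uniform or small — (W1) (`T4ObservableTelescopeTwoRun`) is untouched.  (iv) One-writer: this leaf
imports pv28's `T4CubeChartTransport` BY NAME and modifies nothing there.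
-/

noncomputable section

open _root_.MeasureTheory
open Function (updateFinset)
open scoped BigOperators InnerProductSpace ENNReal

namespace Literature.MathematicalPhysics.QuantumFieldTheory.Balaban1983to89.T4PairResponseChart

open Literature.Probability.Distributions (coordGradient)
open B15.BasicStep T4DressedR T4DressingDefect T4CoReadMoment T4FirstOrderSize T4TiltModulus T4CondLawRelative
  T4ObservableTelescope T4CondMeanChannel T4CovarianceResponse T4CubePoincare T4CubeChartTransport T4CondMeanChannelInsert

section Fibre

variable {P : Params} {j : ℕ} {G : Type*} [GaugeGroup G] [MeasurableSpace G] [HaarData G]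
variable [DecidableEq (PBond P j)]

/-! ## §1  The law path written out -/

omit [GaugeGroup G] [MeasurableSpace G] [HaarData G] in
/-- The interpolant of the law path at `θ`, written out: `χ(V←y)·e^{(1−θ)h₁(V←y) + θh₂(V←y)}` — the Gibbs density with
the convex combination of the two exponents (the window is the old term's). [folklore] -/
theorem expTilt_fibreDensity_lawGap_apply (s : Finset (PBond P j)) (χ h₁ h₂ : Density P j G) (V : GaugeField P j G)
    (θ : ℝ) (y : s → G) :
    expTilt (fibreDensity s (fun U => χ U * Real.exp (h₁ U)) V) (lawGap s h₁ h₂ V) θ y =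
      χ (updateFinset V s y) *
        Real.exp ((1 - θ) * h₁ (updateFinset V s y) + θ * h₂ (updateFinset V s y)) := by
  simp only [fibreDensity, expTilt_apply, lawGap_apply]
  rw [mul_assoc, ← Real.exp_add]
  congr 2
  ring

/-- The law path as the normalised law of the interpolated Gibbs density against the base law of the fibre. [folklore] -/
theorem lawPath_eq_normLaw_interp (s : Finset (PBond P j)) (χ h₁ h₂ : Density P j G) (V : GaugeField P j G) (θ : ℝ) :
    lawPath s χ h₁ h₂ V θ = normLaw (fibreBase s) fun y =>
      χ (updateFinset V s y) * Real.exp ((1 - θ) * h₁ (updateFinset V s y) + θ * h₂ (updateFinset V s y)) := by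
  rw [lawPath, tiltLaw]
  congr 1
  exact funext fun y => expTilt_fibreDensity_lawGap_apply s χ h₁ h₂ V θ y

/-- The law-path variance of a REAL insert, written out: `∫ (F − ∫F dP_θ)² dP_θ`, `P_θ = lawPath s χ h₁ h₂ V θ`.
[folklore] -/
theorem lawPathVar_eq_integral (s : Finset (PBond P j)) (χ h₁ h₂ : Density P j G) (V : GaugeField P j G)
    (F : (s → G) → ℝ) (θ : ℝ) :
    lawPathVar s χ h₁ h₂ V F θ =
      ∫ y, (F y - ∫ t, F t ∂lawPath s χ h₁ h₂ V θ) ^ 2 ∂lawPath s χ h₁ h₂ V θ := by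
  simp only [lawPathVar, tiltVar, tiltMean, lawPath, Real.norm_eq_abs, sq_abs]

/-- The interpolated Gibbs density of the law path is integrable against the base law, for `0 ≤ χ`, `χe^{h₁} ≤ C` and a
`K`-bounded law gap on the fibre through `V` (every real `θ`). [folklore] -/
theorem integrable_lawInterpDensity (s : Finset (PBond P j)) {χ h₁ h₂ : Density P j G} (hχm : Measurable χ)
    (hh₁ : Measurable h₁) (hh₂ : Measurable h₂) (hχ0 : ∀ U, 0 ≤ χ U) {C : ℝ}
    (hC : ∀ U, χ U * Real.exp (h₁ U) ≤ C) (V : GaugeField P j G) {K : ℝ}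
    (hK : ∀ y : s → G, |lawGap s h₁ h₂ V y| ≤ K) (θ : ℝ) :
    Integrable (fun y : s → G => χ (updateFinset V s y) *
      Real.exp ((1 - θ) * h₁ (updateFinset V s y) + θ * h₂ (updateFinset V s y))) (fibreBase s) := by
  have heq : (fun y : s → G => χ (updateFinset V s y) *
      Real.exp ((1 - θ) * h₁ (updateFinset V s y) + θ * h₂ (updateFinset V s y))) =
      expTilt (fibreDensity s (fun U => χ U * Real.exp (h₁ U)) V) (lawGap s h₁ h₂ V) θ :=
    funext fun y => (expTilt_fibreDensity_lawGap_apply s χ h₁ h₂ V θ y).symm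
  rw [heq]
  have hq0 : ∀ y, 0 ≤ fibreDensity s (fun U => χ U * Real.exp (h₁ U)) V y :=
    fun y => mul_nonneg (hχ0 _) (Real.exp_nonneg _)
  have hgm : Measurable (lawGap s h₁ h₂ V) :=
    (hh₁.comp measurable_updateFinset).sub (hh₂.comp measurable_updateFinset)
  refine integrable_of_abs_le (measurable_expTilt
    (measurable_fibreDensity s (hχm.mul (Real.measurable_exp.comp hh₁)) V) hgm θ).aestronglyMeasurable
    (C := Real.exp (|θ| * K) * C) fun y => ?_
  rw [abs_of_nonneg (expTilt_nonneg hq0 _ θ y)]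
  exact (expTilt_le hq0 hK θ y).trans (mul_le_mul_of_nonneg_left (hC _) (Real.exp_nonneg _))

/-! ## §2  Transport: law-path variances are cube variances -/

variable {s : Finset (PBond P j)} {χ₁ : Density P j G} {V : GaugeField P j G} {n : ℕ} {S : ℝ}
  {φ : (Fin n → ℝ) → (s → G)} {jac : (Fin n → ℝ) → ℝ}

omit [GaugeGroup G] [MeasurableSpace G] [HaarData G] in
/-- THE LAW GAP'S CHART REPRESENTATIVE IS `f₂ − f₁`: if `f₁, f₂` agree on the cube with the transported exponents
`jac − h₁(V←φ·)`, `jac − h₂(V←φ·)`, then `lawGap s h₁ h₂ V ∘ φ = f₂ − f₁` on the cube (the log-Jacobian cancels).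
[folklore] -/
theorem lawGap_chart {h₁ h₂ : Density P j G} {f₁ f₂ : (Fin n → ℝ) → ℝ}
    (agree₁ : ∀ x ∈ cube n S, f₁ x = jac x - h₁ (updateFinset V s (φ x)))
    (agree₂ : ∀ x ∈ cube n S, f₂ x = jac x - h₂ (updateFinset V s (φ x))) :
    ∀ x ∈ cube n S, lawGap s h₁ h₂ V (φ x) = f₂ x - f₁ x := fun x hx => by
  rw [lawGap_apply, agree₁ x hx, agree₂ x hx]
  ring

/-- **LAW-PATH VARIANCES ARE CUBE VARIANCES.**  Under the chart hypothesis `CubeChart s χ₁ V n S φ jac` AT THE EXTERIOR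
`V` (pv28's `T4CubeChartTransport.CubeChart`, reference `u₀ := V`), for `C`-bounded measurable Gibbs data with a bounded
law gap and ANY functions `f₁, f₂` agreeing on `K` with the transported endpoint exponents `jac − h₁(V←φ·)`,
`jac − h₂(V←φ·)`: the law-path variance at `θ` of a measurable real insert `F` is the cube variance of `F∘φ` under the
interpolated exponent `(1−θ) f₁ + θ f₂` (`IsCubeImage.variance_normLaw_exp_eq_cubeVar` BY NAME). [folklore] -/
theorem lawPathVar_eq_cubeVar (hc : CubeChart s χ₁ V n S φ jac) {h₁ h₂ : Density P j G} (hχm : Measurable χ₁)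
    (hh₁ : Measurable h₁) (hh₂ : Measurable h₂) (hχ0 : ∀ U, 0 ≤ χ₁ U) {C : ℝ}
    (hC : ∀ U, χ₁ U * Real.exp (h₁ U) ≤ C) {K : ℝ} (hK : ∀ y : s → G, |lawGap s h₁ h₂ V y| ≤ K)
    {f₁ f₂ : (Fin n → ℝ) → ℝ} (agree₁ : ∀ x ∈ cube n S, f₁ x = jac x - h₁ (updateFinset V s (φ x)))
    (agree₂ : ∀ x ∈ cube n S, f₂ x = jac x - h₂ (updateFinset V s (φ x))) {F : (s → G) → ℝ}
    (hF : Measurable F) {θ : ℝ} :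
    lawPathVar s χ₁ h₁ h₂ V F θ = cubeVar (fun x => (1 - θ) * f₁ x + θ * f₂ x) S (fun x => F (φ x)) := by
  rw [lawPathVar_eq_integral, lawPath_eq_normLaw_interp]
  refine hc.variance_normLaw_exp_eq_cubeVar
    (H := fun y => (1 - θ) * h₁ (updateFinset V s y) + θ * h₂ (updateFinset V s y))
    (((hh₁.comp measurable_updateFinset).const_mul _).add ((hh₂.comp measurable_updateFinset).const_mul _))
    (integrable_lawInterpDensity s hχm hh₁ hh₂ hχ0 hC V hK θ) (fun x hx => ?_) hF
  rw [agree₁ x hx, agree₂ x hx]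
  ring

/-! ## §3  The plug: the cube Brascamp–Lieb engine feeds the (PVAR) slots of `pairDom` -/

/-- **THE PLUG.**  Under the chart hypothesis at the exterior `V`, `C`-bounded measurable Gibbs data `0 ≤ χ₁`,
`χ₁e^{h₁} ≤ C`, measurable `h₂`, windows agreeing on the fibre through `V`, a `K`-bounded law gap, `λ > 0`, `C²`
representatives `f₁, f₂` of the transported endpoint exponents with `HessianBound fᵢ λ`, the gap-gradient bound
`|∇(f₂ − f₁)|² ≤ b²` on `K`, and `C¹` representatives of the real inserts `B · b'` (`b' ∈ T`) with `|∇|² ≤ L²` on `K`: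
`V ∈ pairDom s χ₁ χ₂ h₁ h₂ B T (b/√λ) (L/√λ)` — by `T4CubePoincare.cubeVar_le_of_grad_le` along the law path
(`hessianBound_interp_Icc`).  No deviation functional, no reference exterior. [folklore] -/
theorem mem_pairDom_of_cubeChart {β : Type*} (hc : CubeChart s χ₁ V n S φ jac) {χ₂ h₁ h₂ : Density P j G}
    (hχm : Measurable χ₁) (hh₁ : Measurable h₁) (hh₂ : Measurable h₂) (hχ0 : ∀ U, 0 ≤ χ₁ U) {C : ℝ}
    (hC : ∀ U, χ₁ U * Real.exp (h₁ U) ≤ C)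
    (hwin : ∀ y : s → G, χ₂ (updateFinset V s y) = χ₁ (updateFinset V s y)) {K : ℝ}
    (hK : ∀ y : s → G, |lawGap s h₁ h₂ V y| ≤ K) {lam : ℝ} (hlam : 0 < lam) {f₁ f₂ : (Fin n → ℝ) → ℝ}
    (hf₁ : ContDiff ℝ 2 f₁) (hf₂ : ContDiff ℝ 2 f₂) (hB₁ : HessianBound f₁ lam) (hB₂ : HessianBound f₂ lam)
    (agree₁ : ∀ x ∈ cube n S, f₁ x = jac x - h₁ (updateFinset V s (φ x)))
    (agree₂ : ∀ x ∈ cube n S, f₂ x = jac x - h₂ (updateFinset V s (φ x))) {b : ℝ}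
    (hgap : ∀ x ∈ cube n S,
      coordGradient (fun x => f₂ x - f₁ x) x ⬝ᵥ coordGradient (fun x => f₂ x - f₁ x) x ≤ b ^ 2)
    {B : (s → G) → β → ℝ} {T : Finset β} (hBm : ∀ b' ∈ T, Measurable fun y => B y b') {L : ℝ}
    (hBg : ∀ b' ∈ T, ∃ g : (Fin n → ℝ) → ℝ, ContDiff ℝ 1 g ∧ (∀ x ∈ cube n S, g x = B (φ x) b') ∧
      ∀ x ∈ cube n S, coordGradient g x ⬝ᵥ coordGradient g x ≤ L ^ 2) :
    V ∈ pairDom s χ₁ χ₂ h₁ h₂ B T (b / Real.sqrt lam) (L / Real.sqrt lam) := by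
  have hS : 0 < S := hc.S_pos
  have hgm : Measurable (lawGap s h₁ h₂ V) :=
    (hh₁.comp measurable_updateFinset).sub (hh₂.comp measurable_updateFinset)
  have hsq : (Real.sqrt lam) ^ 2 = lam := Real.sq_sqrt hlam.le
  refine ⟨hwin, ⟨K, hK⟩, fun θ hθ => ?_, fun b' hb θ hθ => ?_⟩
  · rw [lawPathVar_eq_cubeVar hc hχm hh₁ hh₂ hχ0 hC hK agree₁ agree₂ hgm]
    have hcongr : cubeVar (fun x => (1 - θ) * f₁ x + θ * f₂ x) S (fun x => lawGap s h₁ h₂ V (φ x)) =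
        cubeVar (fun x => (1 - θ) * f₁ x + θ * f₂ x) S (fun x => f₂ x - f₁ x) :=
      cubeVar_congr_on (lawGap_chart agree₁ agree₂)
    rw [hcongr]
    refine (cubeVar_le_of_grad_le hS hlam (contDiff_combo hf₁ hf₂ _ _)
      (hessianBound_interp_Icc hf₁ hf₂ hB₁ hB₂ hθ) ((hf₂.sub hf₁).of_le one_le_two) hgap).trans_eq ?_
    rw [div_pow, hsq, inv_mul_eq_div]
  · obtain ⟨g, hg, hgB, hgL⟩ := hBg b' hb
    rw [lawPathVar_eq_cubeVar hc hχm hh₁ hh₂ hχ0 hC hK agree₁ agree₂ (hBm b' hb)]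
    have hcongr : cubeVar (fun x => (1 - θ) * f₁ x + θ * f₂ x) S (fun x => B (φ x) b') =
        cubeVar (fun x => (1 - θ) * f₁ x + θ * f₂ x) S g :=
      cubeVar_congr_on fun x hx => (hgB x hx).symm
    rw [hcongr]
    refine (cubeVar_le_of_grad_le hS hlam (contDiff_combo hf₁ hf₂ _ _)
      (hessianBound_interp_Icc hf₁ hf₂ hB₁ hB₂ hθ) hg hgL).trans_eq ?_
    rw [div_pow, hsq, inv_mul_eq_div]

end Fibre

/-! ### The packaged datum and the corollaries by name -/

section Packaged

variable {P : Params} {j : ℕ} {G : Type*} [GaugeGroup G] [MeasurableSpace G] [HaarData G]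
variable [DecidableEq (PBond P j)]
variable {β : Type*}

/-- **PAIR-CHART DATA at the exterior `V` with moduli `(λ, b, L)`** for one term with Gibbs laws `old = χ₁e^{h₁}`,
`ins = χ₂e^{h₂}` and real bond inserts `B` on `T`: the windows agree on the fibre through `V`, the law gap is bounded
there, and SOME cube chart of the windowed fibre law at `V` carries `C²` λ-convex representatives of the two transported
actions with gap-gradient `≤ b` and `C¹` representatives of the inserts with gradient `≤ L`.  Every field is an INPUT
((CHART), (EXT), (HESS), the gradient bounds, (WIN)) — NOT PROVED for Bałaban's densities.  VACUITY NOTE: the tree holds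
NO instance of `CubeChart` on a group fibre yet (only the Euclidean self-chart `T4CubeChartTransport.isCubeImage_indicator`;
the `U(1)` instance is pv28's row T4-O3.E-iii-b-G7-BLWINDOW-CHART-U1*), so no inhabitant of this structure is exhibited
here — it is a located hypothesis list, not a certified one. [folklore] -/
structure PairChartAt (s : Finset (PBond P j)) (χ₁ χ₂ h₁ h₂ : Density P j G) (B : (s → G) → β → ℝ)
    (T : Finset β) (lam b L : ℝ) (V : GaugeField P j G) : Prop where
  /-- (WIN) the windows agree on the fibre through `V` -/
  win : ∀ y : s → G, χ₂ (updateFinset V s y) = χ₁ (updateFinset V s y)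
  /-- the law gap is bounded on the fibre through `V` -/
  gap_bdd : ∃ K : ℝ, ∀ y : s → G, |lawGap s h₁ h₂ V y| ≤ K
  /-- (CHART) + (EXT) + (HESS) + gradient bounds in some cube chart at `V` -/
  chart : ∃ (n : ℕ) (S : ℝ) (φ : (Fin n → ℝ) → (s → G)) (jac f₁ f₂ : (Fin n → ℝ) → ℝ),
    CubeChart s χ₁ V n S φ jac ∧ ContDiff ℝ 2 f₁ ∧ ContDiff ℝ 2 f₂ ∧ HessianBound f₁ lam ∧ HessianBound f₂ lam ∧
    (∀ x ∈ cube n S, f₁ x = jac x - h₁ (updateFinset V s (φ x))) ∧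
    (∀ x ∈ cube n S, f₂ x = jac x - h₂ (updateFinset V s (φ x))) ∧
    (∀ x ∈ cube n S, coordGradient (fun x => f₂ x - f₁ x) x ⬝ᵥ coordGradient (fun x => f₂ x - f₁ x) x ≤ b ^ 2) ∧
    (∀ b' ∈ T, ∃ g : (Fin n → ℝ) → ℝ, ContDiff ℝ 1 g ∧ (∀ x ∈ cube n S, g x = B (φ x) b') ∧
      ∀ x ∈ cube n S, coordGradient g x ⬝ᵥ coordGradient g x ≤ L ^ 2)

/-- Pair-chart data at `V` with moduli `(λ, b, L)` put `V` in the pair-response domain with `σ = b/√λ`, `τ = L/√λ`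
(`mem_pairDom_of_cubeChart`). [folklore] -/
theorem mem_pairDom_of_pairChartAt {s : Finset (PBond P j)} {χ₁ χ₂ h₁ h₂ : Density P j G}
    {B : (s → G) → β → ℝ} {T : Finset β} {lam b L : ℝ} {V : GaugeField P j G}
    (hd : PairChartAt s χ₁ χ₂ h₁ h₂ B T lam b L V) (hχm : Measurable χ₁) (hh₁ : Measurable h₁)
    (hh₂ : Measurable h₂) (hχ0 : ∀ U, 0 ≤ χ₁ U) {C : ℝ} (hC : ∀ U, χ₁ U * Real.exp (h₁ U) ≤ C)
    (hlam : 0 < lam) (hBm : ∀ b' ∈ T, Measurable fun y => B y b') :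
    V ∈ pairDom s χ₁ χ₂ h₁ h₂ B T (b / Real.sqrt lam) (L / Real.sqrt lam) := by
  obtain ⟨K, hK⟩ := hd.gap_bdd
  obtain ⟨n, S, φ, jac, f₁, f₂, hc, hf₁, hf₂, hB₁, hB₂, agree₁, agree₂, hgap, hBg⟩ := hd.chart
  exact mem_pairDom_of_cubeChart hc hχm hh₁ hh₂ hχ0 hC hd.win hK hlam hf₁ hf₂ hB₁ hB₂ agree₁ agree₂ hgap hBm hBg

/-- **§4 (BY NAME TO THE LANE) THE DIRECT TWO-LAW CHANNEL OF THE LINEAR PART FROM PAIR CHARTS.**  For one term with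
Gibbs laws `old = χ₁e^{h₁}`, `ins = χ₂e^{h₂}` (`χ₁, h₁, h₂` measurable, `0 ≤ χ₁`, both laws `≤ C`), real bond inserts
`B` strongly measurable and bounded on `T`, moduli `λ > 0`, `b, L ≥ 0`, and PAIR-CHART DATA `(λ, b, L)` AT EVERY OLD-LIVE
EXTERIOR: `CondMeanGap s ins old (linDensity t T a (fibreReading s B)) (|t|·(|T|·A·(b·L/λ)))` —
`T4CondMeanChannelInsert.condMeanGap_linDensity_of_pairVariance` with `σ = b/√λ`, `τ = L/√λ`. [folklore] -/
theorem condMeanGap_linDensity_of_pairCharts (s : Finset (PBond P j)) {χ₁ χ₂ h₁ h₂ : Density P j G}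
    (hχm : Measurable χ₁) (hh₁ : Measurable h₁) (hh₂ : Measurable h₂) (hχ0 : ∀ U, 0 ≤ χ₁ U) {C : ℝ}
    (hC₁ : ∀ U, χ₁ U * Real.exp (h₁ U) ≤ C) (hC₂ : ∀ U, χ₂ U * Real.exp (h₂ U) ≤ C)
    {B : (s → G) → β → ℝ} {T : Finset β} (hB : ∀ b' ∈ T, StronglyMeasurable fun y => B y b') {R : ℝ}
    (hR : ∀ b' ∈ T, ∀ y, ‖B y b'‖ ≤ R) {lam b L : ℝ} (hlam : 0 < lam) (hb : 0 ≤ b) (hL : 0 ≤ L)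
    (hd : ∀ V ∈ liveSet s (fun U => χ₁ U * Real.exp (h₁ U)), PairChartAt s χ₁ χ₂ h₁ h₂ B T lam b L V)
    (t : ℝ) {a : β → ℝ} {A : ℝ} (hA : ∀ b' ∈ T, ‖a b'‖ ≤ A) :
    CondMeanGap s (fun U => χ₂ U * Real.exp (h₂ U)) (fun U => χ₁ U * Real.exp (h₁ U))
      (linDensity t T a (fibreReading s B)) (|t| * ((T.card : ℝ) * A * (b * L / lam))) := by
  have h := condMeanGap_linDensity_of_pairVariance s hχm hh₁ hh₂ hχ0 hC₁ hC₂ hB hR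
    (div_nonneg hb (Real.sqrt_nonneg _)) (div_nonneg hL (Real.sqrt_nonneg _))
    (fun V hV => mem_pairDom_of_pairChartAt (hd V hV) hχm hh₁ hh₂ hχ0 hC₁ hlam
      fun b' hb' => (hB b' hb').measurable) t hA
  have key : b / Real.sqrt lam * (L / Real.sqrt lam) = b * L / lam := by
    rw [div_mul_div_comm, ← sq, Real.sq_sqrt hlam.le]
  rwa [key] at h

/-- **§4 THE INCREMENT BOUND FROM PAIR CHARTS.**  Under the printed provisos (`TermProvisos`, common bound `C`), for a
nonnegative bounded measurable weight `g` with a bounded measurable fibre-independent reference `m`, the linear density as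
linear part with remainders `q₁`, `q₂`, and pair-chart data `(λ, b, L)` at every old-live exterior:
`|termDefect s ins old g| ≤ (|t|·(|T|·A·(b·L/λ)) + (q₁ + q₂))·∫dV old` —
`T4CondMeanChannelInsert.abs_termDefect_le_of_pairVariance` BY NAME.  Every size is a binder. [folklore] -/
theorem abs_termDefect_le_of_pairCharts {s : Finset (PBond P j)} {χ₁ χ₂ h₁ h₂ : Density P j G} {C : ℝ}
    (hP : TermProvisos s (fun U => χ₂ U * Real.exp (h₂ U)) (fun U => χ₁ U * Real.exp (h₁ U)) C)
    (hχm : Measurable χ₁) (hh₁ : Measurable h₁) (hh₂ : Measurable h₂) (hχ0 : ∀ U, 0 ≤ χ₁ U) {g : Density P j G}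
    (hg : Measurable g) (hg0 : ∀ U, 0 ≤ g U) {Bg : ℝ} (hgB : ∀ U, g U ≤ Bg) {m : Density P j G}
    (hmm : Measurable m) {Bm : ℝ} (hBm : ∀ U, |m U| ≤ Bm) (hmI : FibreIndep s m) (t : ℝ) {T : Finset β}
    {a : β → ℝ} {A : ℝ} (hA : ∀ b' ∈ T, ‖a b'‖ ≤ A) {B : (s → G) → β → ℝ}
    (hB : ∀ b' ∈ T, StronglyMeasurable fun y => B y b') {R : ℝ} (hR : ∀ b' ∈ T, ∀ y, ‖B y b'‖ ≤ R)
    {lam b L : ℝ} (hlam : 0 < lam) (hb : 0 ≤ b) (hL : 0 ≤ L)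
    (hd : ∀ V ∈ liveSet s (fun U => χ₁ U * Real.exp (h₁ U)), PairChartAt s χ₁ χ₂ h₁ h₂ B T lam b L V)
    {q₁ q₂ : ℝ}
    (hq₁ : ∀ (V : GaugeField P j G) (y : s → G),
      χ₁ (updateFinset V s y) * Real.exp (h₁ (updateFinset V s y)) ≠ 0 →
      |g (updateFinset V s y) - m V - linDensity t T a (fibreReading s B) (updateFinset V s y)| ≤ q₁)
    (hq₂ : ∀ V ∈ liveSet s (fun U => χ₁ U * Real.exp (h₁ U)), ∀ y : s → G,
      χ₂ (updateFinset V s y) * Real.exp (h₂ (updateFinset V s y)) ≠ 0 →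
      |g (updateFinset V s y) - m V - linDensity t T a (fibreReading s B) (updateFinset V s y)| ≤ q₂) :
    |termDefect s (fun U => χ₂ U * Real.exp (h₂ U)) (fun U => χ₁ U * Real.exp (h₁ U)) g|
      ≤ (|t| * ((T.card : ℝ) * A * (b * L / lam)) + (q₁ + q₂)) *
        ∫ V, χ₁ V * Real.exp (h₁ V) ∂fieldMeasure P j G := by
  have h := abs_termDefect_le_of_pairVariance hP hχm hh₁ hh₂ hχ0 hg hg0 hgB hmm hBm hmI t hA hB hR
    (div_nonneg hb (Real.sqrt_nonneg _)) (div_nonneg hL (Real.sqrt_nonneg _))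
    (fun V hV => mem_pairDom_of_pairChartAt (hd V hV) hχm hh₁ hh₂ hχ0 hP.old_le hlam
      fun b' hb' => (hB b' hb').measurable) hq₁ hq₂
  have key : b / Real.sqrt lam * (L / Real.sqrt lam) = b * L / lam := by
    rw [div_mul_div_comm, ← sq, Real.sq_sqrt hlam.le]
  rwa [key] at h

end Packaged

/-! ## §5  (v1.1, APPEND-ONLY over v1 p185528: §1–§4 unchanged) Monotonicity and closure of `pairDom` in `(σ, τ)` —
the `ε ↓ 0` step of caveat (EXT)

As for pv28's `respDom` (`T4CubeChartTransport` §3): the extension lemma behind (EXT) loses an arbitrarily small amount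
of convexity (`λ' < λ`), and nothing is lost in the conclusion because the two variance slots of `pairDom` are CLOSED
conditions in `(σ, τ)`.  Pure bookkeeping on `pairDom`; [folklore]. -/

section Closure

variable {P : Params} {j : ℕ} {G : Type*} [GaugeGroup G] [MeasurableSpace G] [HaarData G]
variable [DecidableEq (PBond P j)]
variable {E : Type*} [NormedAddCommGroup E] [InnerProductSpace ℝ E]
variable {β : Type*} {s : Finset (PBond P j)} {χ₁ χ₂ h₁ h₂ : Density P j G} {V : GaugeField P j G}
  {B : (s → G) → β → E} {T : Finset β}

/-- `pairDom` is monotone in `(σ, τ)` (for `0 ≤ σ`, `0 ≤ τ`). [folklore] -/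
theorem pairDom_mono {σ σ' τ τ' : ℝ} (hσ : 0 ≤ σ) (hσσ' : σ ≤ σ') (hτ : 0 ≤ τ) (hττ' : τ ≤ τ') :
    pairDom s χ₁ χ₂ h₁ h₂ B T σ τ ⊆ pairDom s χ₁ χ₂ h₁ h₂ B T σ' τ' := by
  intro v hv
  rw [pairDom, Set.mem_setOf_eq] at hv ⊢
  obtain ⟨hwin, hK, hgap, hB⟩ := hv
  exact ⟨hwin, hK, fun θ hθ => (hgap θ hθ).trans (pow_le_pow_left₀ hσ hσσ' 2),
    fun b hb θ hθ => (hB b hb θ hθ).trans (pow_le_pow_left₀ hτ hττ' 2)⟩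

open Filter Topology in
/-- **Closure in `(σ, τ)`.**  If `V ∈ pairDom … σ' τ'` for all `σ' > σ` and all `τ' > τ`, then `V ∈ pairDom … σ τ`.
[folklore] -/
theorem mem_pairDom_of_forall_gt {σ τ : ℝ}
    (hmem : ∀ σ' τ' : ℝ, σ < σ' → τ < τ' → V ∈ pairDom s χ₁ χ₂ h₁ h₂ B T σ' τ') :
    V ∈ pairDom s χ₁ χ₂ h₁ h₂ B T σ τ := by
  have h1 := hmem (σ + 1) (τ + 1) (lt_add_one σ) (lt_add_one τ)
  rw [pairDom, Set.mem_setOf_eq] at h1 ⊢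
  obtain ⟨hwin, hK, -, -⟩ := h1
  refine ⟨hwin, hK, fun θ hθ => ?_, fun b hb θ hθ => ?_⟩
  · have ht : Tendsto (fun σ' : ℝ => σ' ^ 2) (𝓝[>] σ) (𝓝 (σ ^ 2)) :=
      ((continuous_id.pow 2).continuousAt).continuousWithinAt.tendsto
    refine ge_of_tendsto ht (eventually_nhdsWithin_of_forall fun σ' hσ' => ?_)
    have hm := hmem σ' (τ + 1) hσ' (lt_add_one τ)
    rw [pairDom, Set.mem_setOf_eq] at hm
    exact hm.2.2.1 θ hθ
  · have ht : Tendsto (fun τ' : ℝ => τ' ^ 2) (𝓝[>] τ) (𝓝 (τ ^ 2)) :=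
      ((continuous_id.pow 2).continuousAt).continuousWithinAt.tendsto
    refine ge_of_tendsto ht (eventually_nhdsWithin_of_forall fun τ' hτ' => ?_)
    have hm := hmem (σ + 1) τ' (lt_add_one σ) hτ'
    rw [pairDom, Set.mem_setOf_eq] at hm
    exact hm.2.2.2 b hb θ hθ

open Filter Topology in
/-- **The `ε ↓ 0` step of (EXT) for the pair response.**  If `V ∈ pairDom … (b/√λ') (L/√λ')` for every
`λ' ∈ (0, λ)` — e.g. from `mem_pairDom_of_cubeChart` with `λ'`-convex global representatives for each `λ' < λ` — then
`V ∈ pairDom … (b/√λ) (L/√λ)` (`0 < λ`, `0 ≤ b`, `0 ≤ L`). [folklore] -/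
theorem mem_pairDom_of_forall_lt_modulus {lam b L : ℝ} (hlam : 0 < lam) (hb : 0 ≤ b) (hL : 0 ≤ L)
    (hmem : ∀ lam' ∈ Set.Ioo 0 lam, V ∈ pairDom s χ₁ χ₂ h₁ h₂ B T (b / Real.sqrt lam') (L / Real.sqrt lam')) :
    V ∈ pairDom s χ₁ χ₂ h₁ h₂ B T (b / Real.sqrt lam) (L / Real.sqrt lam) := by
  refine mem_pairDom_of_forall_gt fun σ' τ' hσ' hτ' => ?_
  have hsq : Real.sqrt lam ≠ 0 := (Real.sqrt_pos.2 hlam).ne'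
  have hσt : Tendsto (fun x : ℝ => b / Real.sqrt x) (𝓝[<] lam) (𝓝 (b / Real.sqrt lam)) :=
    (continuousAt_const.div Real.continuous_sqrt.continuousAt hsq).continuousWithinAt.tendsto
  have hτt : Tendsto (fun x : ℝ => L / Real.sqrt x) (𝓝[<] lam) (𝓝 (L / Real.sqrt lam)) :=
    (continuousAt_const.div Real.continuous_sqrt.continuousAt hsq).continuousWithinAt.tendsto
  have hev : ∀ᶠ x in 𝓝[<] lam, b / Real.sqrt x < σ' ∧ L / Real.sqrt x < τ' ∧ 0 < x ∧ x < lam :=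
    (hσt.eventually (gt_mem_nhds hσ')).and ((hτt.eventually (gt_mem_nhds hτ')).and
      (((lt_mem_nhds hlam).filter_mono nhdsWithin_le_nhds).and
        (eventually_nhdsWithin_of_forall fun x hx => hx)))
  obtain ⟨x, hxσ, hxτ, hx0, hxl⟩ := hev.exists
  exact pairDom_mono (div_nonneg hb (Real.sqrt_nonneg _)) hxσ.le (div_nonneg hL (Real.sqrt_nonneg _)) hxτ.le
    (hmem x ⟨hx0, hxl⟩)

end Closure

end Literature.MathematicalPhysics.QuantumFieldTheory.Balaban1983to89.T4PairResponseChart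

end
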